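import Mathlib.Data.Nat.Choose.Basic
import Mathlib.Algebra.BigOperators.Intervals
import Mathlib.Algebra.Order.BigOperators.Group.Finset
import Mathlib.Tactic
import Summits.CriticalPhenomena.PercolationContinuityZ3.Theorems.PercNearOneGluingNoHeavyLowerTailPeakTilt
import Summits.CriticalPhenomena.PercolationContinuityZ3.Theorems.PercNearOneGluingNoHeavyLowerTailHypMoments
import Summits.CriticalPhenomena.PercolationContinuityZ3.Theorems.PercNearOneGluingNoHeavyLowerTailCoreCov
import HarnessLib

/-!
# The off-centre two-block inequality TEST(1) (towards (Ω₁) at θ-level)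

Support file for the Sahi / Conjecture-P programme of route `PercNearOneGluingNoHeavy`
(`--supports stmt-CriticalPhenomena-4575`, prover prim-l12-p5 gen 27; note `prim-l12-p5/OMEGA1-g27.md` §5).
No definitions, no named facts, no sorries.

Setting (note §1, §5).  The fixed-hit-set inequality (Ω₁) at θ-level follows, by a Beta mixture of
symmetrised biased colourings and the decomposition 'biased coin = sure head + fair coin', from the
family TEST(j) of two-block inequalities taken at the OFF-CENTRE section `k₁ + k₂ = (n₁+n₂-j)/2`:
`0 ≤ (n₁+n₂-1+j)·∑_k Mo₁(k)Mo₂(K'-k) + Mc₁Mc₂·∑_k F₁(k)F₂(K'-k)` for blocks with the one-block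
properties of `CoreBlock` (as abstracted in `CoreCov.core_abstract`, which is TEST(0)).  This file proves
TEST(1) (`test_one`): for `n₁ + n₂ = 2K' + 1`,
`0 ≤ (n₁+n₂)·∑_{k ≤ K'} Mo₁(k)Mo₂(K'-k) + Mc₁Mc₂·∑_{k ≤ K'} F₁(k)F₂(K'-k)`.
Steps: `hyp_offcentre_moment` (`(n₁+n₂)·∑ C(n₁,k)C(n₂,K'-k)(2k-n₁)(2k-n₁+1) = n₁n₂·∑ C(n₁,k)C(n₂,K'-k)`),
`prod_bound_one` (termwise `0 ≤ n₁n₂Mo₁Mo₂ + (2k₁-n₁)(2k₁-n₁+1)Mc₁Mc₂F₁F₂` when `2k₁+2k₂ = n₁+n₂-1`),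
`offcentre_moment_bound` (weighted Chebyshev `PeakTilt.tilted_moment_le` with the order parameter
`(2k-n₁)(2k-n₁+1)`, against which both normalised block weights are antitone by `CoreCov.psi_anti`),
and the assembly `test_one`.
-/

namespace Summit.CriticalPhenomena.PercolationContinuityZ3.Theorems

namespace OffCentre

open Finset

/-- Off-centre second moment of the hypergeometric law: for `n₁ + n₂ = 2K'+1`,
`(n₁+n₂) · ∑_k C(n₁,k)C(n₂,K'-k)(2k-n₁)(2k-n₁+1) = n₁n₂ · ∑_k C(n₁,k)C(n₂,K'-k)`. -/
theorem hyp_offcentre_moment (n₁ n₂ K : ℕ) (hN : n₁ + n₂ = 2 * K + 1) :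
    ((n₁ : ℝ) + n₂) * ∑ k ∈ range (K + 1),
        (n₁.choose k : ℝ) * (n₂.choose (K - k) : ℝ) * ((2 * (k : ℝ) - n₁) * (2 * (k : ℝ) - n₁ + 1)) =
      (n₁ : ℝ) * n₂ * ∑ k ∈ range (K + 1), (n₁.choose k : ℝ) * (n₂.choose (K - k) : ℝ) := by
  set S0 := ∑ k ∈ range (K + 1), (n₁.choose k : ℝ) * (n₂.choose (K - k) : ℝ) with hS0
  set S1 := ∑ k ∈ range (K + 1), (k : ℝ) * (n₁.choose k : ℝ) * (n₂.choose (K - k) : ℝ) with hS1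
  set S2 := ∑ k ∈ range (K + 1), (k : ℝ) * ((k : ℝ) - 1) * (n₁.choose k : ℝ) *
    (n₂.choose (K - k) : ℝ) with hS2
  have hsq : ∑ k ∈ range (K + 1), (n₁.choose k : ℝ) * (n₂.choose (K - k) : ℝ) *
      ((2 * (k : ℝ) - n₁) * (2 * (k : ℝ) - n₁ + 1)) =
      4 * S2 + (6 - 4 * (n₁ : ℝ)) * S1 + (n₁ : ℝ) * ((n₁ : ℝ) - 1) * S0 := by
    rw [hS0, hS1, hS2, mul_sum, mul_sum, mul_sum, ← sum_add_distrib, ← sum_add_distrib]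
    refine sum_congr rfl fun k _ => ?_
    ring
  have h1 := HypMoments.first_moment n₁ n₂ K
  have h2 := HypMoments.second_fact_moment n₁ n₂ K
  rw [← hS0, ← hS1] at h1
  rw [← hS0, ← hS2] at h2
  have hNr : (n₁ : ℝ) + n₂ = 2 * K + 1 := by exact_mod_cast hN
  rw [hNr] at h1 h2
  rw [hsq, hNr]
  have hn2r : (n₂ : ℝ) = 2 * K + 1 - n₁ := by linarith
  rw [hn2r]
  -- (2K+1) S1 = n₁ K S0 ;  (2K+1)(2K) S2 = n₁(n₁-1)K(K-1) S0
  rcases Nat.eq_zero_or_pos K with hK | hK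
  · subst hK
    have hn1 : n₁ ≤ 1 := by omega
    -- S2 = 0 and S1, S0 explicit: sums over range 1
    have e2 : S2 = 0 := by
      rw [hS2]
      simp
    have e1 : S1 = 0 := by
      rw [hS1]
      simp
    rw [e1, e2]
    interval_cases n₁ <;> simp
  have hKr : (K : ℝ) ≠ 0 := by exact_mod_cast hK.ne'
  have h2' : (2 * (K : ℝ) + 1) * (2 * S2) = (n₁ : ℝ) * ((n₁ : ℝ) - 1) * ((K : ℝ) - 1) * S0 := by
    apply mul_left_cancel₀ hKr
    linear_combination h2
  linear_combination 2 * h2' + (6 - 4 * (n₁ : ℝ)) * h1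

/-- Termwise product bound at the section shifted by one half-step:
for `k₁ ≤ n₁`, `k₂ ≤ n₂`, `2k₁ + 2k₂ + 1 = n₁ + n₂`,
`0 ≤ n₁n₂·Mo₁(k₁)Mo₂(k₂) + (2k₁-n₁)(2k₁-n₁+1)·Mc₁Mc₂·F₁(k₁)F₂(k₂)`. -/
theorem prod_bound_one (n₁ n₂ k₁ k₂ : ℕ) (Mc₁ Mc₂ : ℝ) (F₁ Mo₁ F₂ Mo₂ : ℕ → ℝ)
    (hk₁ : k₁ ≤ n₁) (hk₂ : k₂ ≤ n₂) (hsum : 2 * k₁ + 2 * k₂ + 1 = n₁ + n₂)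
    (hF₁sym : ∀ k, k ≤ n₁ → F₁ (n₁ - k) = F₁ k) (hMo₁odd : ∀ k, k ≤ n₁ → Mo₁ (n₁ - k) = -Mo₁ k)
    (hMo₁pos : ∀ k, n₁ ≤ 2 * k → 0 ≤ Mo₁ k)
    (hMo₁up : ∀ k, n₁ ≤ 2 * k → (n₁ : ℝ) * Mo₁ k ≤ (2 * (k : ℝ) - n₁) * Mc₁ * F₁ k)
    (hF₂sym : ∀ k, k ≤ n₂ → F₂ (n₂ - k) = F₂ k) (hMo₂odd : ∀ k, k ≤ n₂ → Mo₂ (n₂ - k) = -Mo₂ k)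
    (hMo₂pos : ∀ k, n₂ ≤ 2 * k → 0 ≤ Mo₂ k)
    (hMo₂up : ∀ k, n₂ ≤ 2 * k → (n₂ : ℝ) * Mo₂ k ≤ (2 * (k : ℝ) - n₂) * Mc₂ * F₂ k) :
    0 ≤ (n₁ : ℝ) * n₂ * (Mo₁ k₁ * Mo₂ k₂) +
      ((2 * (k₁ : ℝ) - n₁) * (2 * (k₁ : ℝ) - n₁ + 1)) * (Mc₁ * Mc₂) * (F₁ k₁ * F₂ k₂) := by
  have hn₁ : (0 : ℝ) ≤ (n₁ : ℝ) := by positivity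
  have hn₂ : (0 : ℝ) ≤ (n₂ : ℝ) := by positivity
  have hsr : 2 * (k₁ : ℝ) + 2 * k₂ + 1 = (n₁ : ℝ) + n₂ := by exact_mod_cast hsum
  rcases le_or_gt n₁ (2 * k₁) with h1 | h1
  · -- block 1 at/above centre, block 2 strictly below: reflect block 2
    set k₂' := n₂ - k₂ with hk₂'
    have ek₂ : k₂ = n₂ - k₂' := by omega
    have hc : n₂ ≤ 2 * k₂' := by omega
    have hMo : Mo₂ k₂ = -Mo₂ k₂' := by rw [ek₂, hMo₂odd k₂' (by omega)]
    have hF : F₂ k₂ = F₂ k₂' := by rw [ek₂, hF₂sym k₂' (by omega)]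
    have hd : 2 * (k₂' : ℝ) - n₂ = 2 * (k₁ : ℝ) - n₁ + 1 := by
      have : ((k₂' : ℕ) : ℝ) = (n₂ : ℝ) - k₂ := by
        rw [hk₂']
        push_cast [Nat.cast_sub hk₂]
        ring
      rw [this]
      linarith
    have a0 := hMo₁pos k₁ h1
    have aA := hMo₁up k₁ h1
    have b0 := hMo₂pos k₂' hc
    have bB := hMo₂up k₂' hc
    rw [hd] at bB
    have key : ((n₁ : ℝ) * Mo₁ k₁) * ((n₂ : ℝ) * Mo₂ k₂') ≤
        ((2 * (k₁ : ℝ) - n₁) * Mc₁ * F₁ k₁) * ((2 * (k₁ : ℝ) - n₁ + 1) * Mc₂ * F₂ k₂') :=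
      mul_le_mul aA bB (mul_nonneg hn₂ b0) (le_trans (mul_nonneg hn₁ a0) aA)
    rw [hMo, hF]
    nlinarith [key]
  · -- block 1 strictly below centre, block 2 at/above: reflect block 1
    have h2 : n₂ ≤ 2 * k₂ := by omega
    set k₁' := n₁ - k₁ with hk₁'
    have ek₁ : k₁ = n₁ - k₁' := by omega
    have hc : n₁ ≤ 2 * k₁' := by omega
    have hMo : Mo₁ k₁ = -Mo₁ k₁' := by rw [ek₁, hMo₁odd k₁' (by omega)]
    have hF : F₁ k₁ = F₁ k₁' := by rw [ek₁, hF₁sym k₁' (by omega)]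
    have hd₁ : ((k₁' : ℕ) : ℝ) = (n₁ : ℝ) - k₁ := by
      rw [hk₁']
      push_cast [Nat.cast_sub hk₁]
      ring
    -- 2k₁' - n₁ = -(2k₁ - n₁) = n₁ - 2k₁ and 2k₂ - n₂ = n₁ - 2k₁ - 1
    have a0 := hMo₁pos k₁' hc
    have aA := hMo₁up k₁' hc
    have b0 := hMo₂pos k₂ h2
    have bB := hMo₂up k₂ h2
    have e1 : 2 * (k₁' : ℝ) - n₁ = -(2 * (k₁ : ℝ) - n₁) := by rw [hd₁]; ring
    have e2 : 2 * (k₂ : ℝ) - n₂ = -(2 * (k₁ : ℝ) - n₁ + 1) := by linarith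
    rw [e1] at aA
    rw [e2] at bB
    have key : ((n₁ : ℝ) * Mo₁ k₁') * ((n₂ : ℝ) * Mo₂ k₂) ≤
        ((-(2 * (k₁ : ℝ) - n₁)) * Mc₁ * F₁ k₁') * ((-(2 * (k₁ : ℝ) - n₁ + 1)) * Mc₂ * F₂ k₂) :=
      mul_le_mul aA bB (mul_nonneg hn₂ b0) (le_trans (mul_nonneg hn₁ a0) aA)
    rw [hMo, hF]
    nlinarith [key]

/-- The off-centre version of step (B2): for `n₁ + n₂ = 2K'+1`, `n₁ ≥ 1`,
`(n₁+n₂) · ∑_k (2k-n₁)(2k-n₁+1) F₁(k)F₂(K'-k) ≤ n₁n₂ · ∑_k F₁(k)F₂(K'-k)`.  The order parameter is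
`(2k-n₁)(2k-n₁+1)` itself: parity makes it injective-monotone across the two sides of the section, and
both normalised weights are antitone in it (`CoreCov.psi_anti`). -/
theorem offcentre_moment_bound (n₁ n₂ K : ℕ) (hN : n₁ + n₂ = 2 * K + 1) (hn₁ : 1 ≤ n₁)
    (F₁ F₂ : ℕ → ℝ)
    (hF₁0 : ∀ k, 0 ≤ F₁ k) (hF₁z : ∀ k, n₁ < k → F₁ k = 0) (hF₁sym : ∀ k, k ≤ n₁ → F₁ (n₁ - k) = F₁ k)
    (hF₁step : ∀ k, n₁ ≤ 2 * k + 1 → ((k : ℝ) + 1) * F₁ (k + 1) ≤ ((n₁ : ℝ) - k) * F₁ k)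
    (hF₂0 : ∀ k, 0 ≤ F₂ k) (hF₂z : ∀ k, n₂ < k → F₂ k = 0) (hF₂sym : ∀ k, k ≤ n₂ → F₂ (n₂ - k) = F₂ k)
    (hF₂step : ∀ k, n₂ ≤ 2 * k + 1 → ((k : ℝ) + 1) * F₂ (k + 1) ≤ ((n₂ : ℝ) - k) * F₂ k) :
    ((n₁ : ℝ) + n₂) * ∑ k ∈ range (K + 1),
        ((2 * (k : ℝ) - n₁) * (2 * (k : ℝ) - n₁ + 1)) * (F₁ k * F₂ (K - k)) ≤
      (n₁ : ℝ) * n₂ * ∑ k ∈ range (K + 1), F₁ k * F₂ (K - k) := by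
  have hvar := hyp_offcentre_moment n₁ n₂ K hN
  set ν₀ : ℕ → ℝ := fun k => (n₁.choose k : ℝ) * (n₂.choose (K - k) : ℝ) with hν₀
  set Ψ : ℕ → ℝ := fun k => (F₁ k / (n₁.choose k : ℝ)) * (F₂ (K - k) / (n₂.choose (K - k) : ℝ))
    with hΨ
  set φ : ℕ → ℝ := fun k => (2 * (k : ℝ) - n₁) * (2 * (k : ℝ) - n₁ + 1) with hφ
  have hνΨ : ∀ k, F₁ k * F₂ (K - k) = ν₀ k * Ψ k := by
    intro k
    rw [CoreCov.F_eq_choose_mul_psi n₁ F₁ hF₁z k, CoreCov.F_eq_choose_mul_psi n₂ F₂ hF₂z (K - k)]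
    simp only [hν₀, hΨ]
    ring
  have hsum1 : ∑ k ∈ range (K + 1), ((2 * (k : ℝ) - n₁) * (2 * (k : ℝ) - n₁ + 1)) * (F₁ k * F₂ (K - k)) =
      ∑ k ∈ range (K + 1), ν₀ k * (φ k * Ψ k) := by
    refine sum_congr rfl fun k _ => ?_
    rw [hνΨ k]
    simp only [hφ]
    ring
  have hsum2 : ∑ k ∈ range (K + 1), F₁ k * F₂ (K - k) = ∑ k ∈ range (K + 1), ν₀ k * Ψ k :=
    sum_congr rfl fun k _ => hνΨ k
  have hsum3 : ∑ k ∈ range (K + 1), (n₁.choose k : ℝ) * (n₂.choose (K - k) : ℝ) *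
      ((2 * (k : ℝ) - n₁) * (2 * (k : ℝ) - n₁ + 1)) = ∑ k ∈ range (K + 1), ν₀ k * φ k :=
    sum_congr rfl fun k _ => by simp only [hν₀, hφ]
  have hsum4 : ∑ k ∈ range (K + 1), (n₁.choose k : ℝ) * (n₂.choose (K - k) : ℝ) =
      ∑ k ∈ range (K + 1), ν₀ k := sum_congr rfl fun k _ => by simp only [hν₀]
  rw [hsum1, hsum2]
  rw [hsum3, hsum4] at hvar
  have hν : ∀ i ∈ range (K + 1), 0 ≤ ν₀ i := fun i _ => by
    simp only [hν₀]
    positivity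
  -- antitonicity of Ψ along φ
  have hmono : ∀ i ∈ range (K + 1), ∀ j ∈ range (K + 1), φ i ≤ φ j → Ψ j ≤ Ψ i := by
    intro i hi j hj hφij
    have hiK : i ≤ K := by
      have := mem_range.mp hi
      omega
    have hjK : j ≤ K := by
      have := mem_range.mp hj
      omega
    simp only [hφ] at hφij
    -- from φ i ≤ φ j: (i-j)(2(i+j) - 2n₁ + 1) ≤ 0, and by integrality the two sign conditions
    have hcases : (i ≤ j ∧ n₁ ≤ i + j) ∨ (j ≤ i ∧ i + j + 1 ≤ n₁) := by
      rcases le_total i j with hij | hji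
      · rcases le_or_gt n₁ (i + j) with h | h
        · exact Or.inl ⟨hij, h⟩
        · rcases eq_or_lt_of_le hij with heq | hlt
          · exact Or.inr ⟨heq ▸ le_rfl, by omega⟩
          · exfalso
            have h1 : (i : ℝ) + 1 ≤ j := by exact_mod_cast hlt
            have h2 : (i : ℝ) + j + 1 ≤ n₁ := by exact_mod_cast (by omega : i + j + 1 ≤ n₁)
            nlinarith [hφij, h1, h2]
      · rcases le_or_gt (i + j + 1) n₁ with h | h
        · exact Or.inr ⟨hji, h⟩
        · rcases eq_or_lt_of_le hji with heq | hlt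
          · exact Or.inl ⟨heq ▸ le_rfl, by omega⟩
          · exfalso
            have h1 : (j : ℝ) + 1 ≤ i := by exact_mod_cast hlt
            have h2 : (n₁ : ℝ) ≤ (i : ℝ) + j := by exact_mod_cast (by omega : n₁ ≤ i + j)
            nlinarith [hφij, h1, h2]
    have hprod1 : ((i : ℝ) - j) * ((i : ℝ) + j - n₁) ≤ 0 := by
      rcases hcases with ⟨h1, h2⟩ | ⟨h1, h2⟩
      · have a : (i : ℝ) ≤ j := by exact_mod_cast h1
        have b : (n₁ : ℝ) ≤ (i : ℝ) + j := by exact_mod_cast h2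
        nlinarith
      · have a : (j : ℝ) ≤ i := by exact_mod_cast h1
        have b : (i : ℝ) + j + 1 ≤ n₁ := by exact_mod_cast h2
        nlinarith
    have hprod2 : (((K - i : ℕ) : ℝ) - ((K - j : ℕ) : ℝ)) *
        (((K - i : ℕ) : ℝ) + ((K - j : ℕ) : ℝ) - n₂) ≤ 0 := by
      have hNr : (n₁ : ℝ) + n₂ = 2 * K + 1 := by exact_mod_cast hN
      push_cast [Nat.cast_sub hiK, Nat.cast_sub hjK]
      rcases hcases with ⟨h1, h2⟩ | ⟨h1, h2⟩
      · have a : (i : ℝ) ≤ j := by exact_mod_cast h1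
        have b : (n₁ : ℝ) ≤ (i : ℝ) + j := by exact_mod_cast h2
        nlinarith
      · have a : (j : ℝ) ≤ i := by exact_mod_cast h1
        have b : (i : ℝ) + j + 1 ≤ n₁ := by exact_mod_cast h2
        nlinarith
    have h1 := CoreCov.psi_anti n₁ F₁ hF₁0 hF₁z hF₁sym hF₁step i j hprod1
    have h2 := CoreCov.psi_anti n₂ F₂ hF₂0 hF₂z hF₂sym hF₂step (K - i) (K - j) hprod2
    simp only [hΨ]
    exact mul_le_mul h1 h2 (div_nonneg (hF₂0 _) (by positivity))
      (div_nonneg (hF₁0 _) (by positivity))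
  have hcheb := PeakTilt.tilted_moment_le (range (K + 1)) ν₀ Ψ φ φ hν
    (fun i _ j _ h => h) hmono
  have hB : 0 < ∑ k ∈ range (K + 1), ν₀ k := by
    rw [← hsum4, HypMoments.vandermonde]
    exact_mod_cast Nat.choose_pos (by omega)
  have hN1 : (0 : ℝ) ≤ (n₁ : ℝ) + n₂ := by positivity
  have key : (((n₁ : ℝ) + n₂) * ∑ k ∈ range (K + 1), ν₀ k * (φ k * Ψ k)) *
      (∑ k ∈ range (K + 1), ν₀ k) ≤
      ((n₁ : ℝ) * n₂ * ∑ k ∈ range (K + 1), ν₀ k * Ψ k) * (∑ k ∈ range (K + 1), ν₀ k) := by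
    have := mul_le_mul_of_nonneg_left hcheb hN1
    calc (((n₁ : ℝ) + n₂) * ∑ k ∈ range (K + 1), ν₀ k * (φ k * Ψ k)) * (∑ k ∈ range (K + 1), ν₀ k)
        = ((n₁ : ℝ) + n₂) * ((∑ k ∈ range (K + 1), ν₀ k * (φ k * Ψ k)) *
          (∑ k ∈ range (K + 1), ν₀ k)) := by ring
      _ ≤ ((n₁ : ℝ) + n₂) * ((∑ k ∈ range (K + 1), ν₀ k * φ k) *
          (∑ k ∈ range (K + 1), ν₀ k * Ψ k)) := this
      _ = (((n₁ : ℝ) + n₂) * (∑ k ∈ range (K + 1), ν₀ k * φ k)) *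
          (∑ k ∈ range (K + 1), ν₀ k * Ψ k) := by ring
      _ = ((n₁ : ℝ) * n₂ * ∑ k ∈ range (K + 1), ν₀ k) * (∑ k ∈ range (K + 1), ν₀ k * Ψ k) := by
          rw [hvar]
      _ = ((n₁ : ℝ) * n₂ * ∑ k ∈ range (K + 1), ν₀ k * Ψ k) * (∑ k ∈ range (K + 1), ν₀ k) := by ring
  exact le_of_mul_le_mul_right key hB

/-- **TEST(1) (note §5.3, THEOREM).**  Two blocks with the one-block properties of `CoreBlock`
(positivity, support, symmetry/oddness, sign and upper bound (B1) above the centre with scale constants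
`Mc_b ≥ 0`, EXTENDED-LEMMA-Φ step), sizes `n₁, n₂ ≥ 1` with `n₁ + n₂ = 2K'+1`.  Then at the section
`k₁ + k₂ = K'` (half a step below the centre)
`0 ≤ (n₁+n₂) · ∑_{k ≤ K'} Mo₁(k)Mo₂(K'-k) + Mc₁Mc₂ · ∑_{k ≤ K'} F₁(k)F₂(K'-k)`. -/
theorem test_one (n₁ n₂ K : ℕ) (hN : n₁ + n₂ = 2 * K + 1) (hn₁ : 1 ≤ n₁) (hn₂ : 1 ≤ n₂)
    (Mc₁ Mc₂ : ℝ) (hMc₁ : 0 ≤ Mc₁) (hMc₂ : 0 ≤ Mc₂) (F₁ Mo₁ F₂ Mo₂ : ℕ → ℝ)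
    (hF₁0 : ∀ k, 0 ≤ F₁ k) (hF₁z : ∀ k, n₁ < k → F₁ k = 0) (hF₁sym : ∀ k, k ≤ n₁ → F₁ (n₁ - k) = F₁ k)
    (hF₁step : ∀ k, n₁ ≤ 2 * k + 1 → ((k : ℝ) + 1) * F₁ (k + 1) ≤ ((n₁ : ℝ) - k) * F₁ k)
    (hMo₁z : ∀ k, n₁ < k → Mo₁ k = 0) (hMo₁odd : ∀ k, k ≤ n₁ → Mo₁ (n₁ - k) = -Mo₁ k)
    (hMo₁pos : ∀ k, n₁ ≤ 2 * k → 0 ≤ Mo₁ k)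
    (hMo₁up : ∀ k, n₁ ≤ 2 * k → (n₁ : ℝ) * Mo₁ k ≤ (2 * (k : ℝ) - n₁) * Mc₁ * F₁ k)
    (hF₂0 : ∀ k, 0 ≤ F₂ k) (hF₂z : ∀ k, n₂ < k → F₂ k = 0) (hF₂sym : ∀ k, k ≤ n₂ → F₂ (n₂ - k) = F₂ k)
    (hF₂step : ∀ k, n₂ ≤ 2 * k + 1 → ((k : ℝ) + 1) * F₂ (k + 1) ≤ ((n₂ : ℝ) - k) * F₂ k)
    (hMo₂z : ∀ k, n₂ < k → Mo₂ k = 0) (hMo₂odd : ∀ k, k ≤ n₂ → Mo₂ (n₂ - k) = -Mo₂ k)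
    (hMo₂pos : ∀ k, n₂ ≤ 2 * k → 0 ≤ Mo₂ k)
    (hMo₂up : ∀ k, n₂ ≤ 2 * k → (n₂ : ℝ) * Mo₂ k ≤ (2 * (k : ℝ) - n₂) * Mc₂ * F₂ k) :
    0 ≤ ((n₁ : ℝ) + n₂) * ∑ k ∈ range (K + 1), Mo₁ k * Mo₂ (K - k) +
      Mc₁ * Mc₂ * ∑ k ∈ range (K + 1), F₁ k * F₂ (K - k) := by
  have hterm : ∀ k ∈ range (K + 1), 0 ≤ (n₁ : ℝ) * n₂ * (Mo₁ k * Mo₂ (K - k)) +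
      ((2 * (k : ℝ) - n₁) * (2 * (k : ℝ) - n₁ + 1)) * (Mc₁ * Mc₂) * (F₁ k * F₂ (K - k)) := by
    intro k hk
    have hkK : k ≤ K := by
      have := mem_range.mp hk
      omega
    rcases Nat.lt_or_ge n₁ k with h1 | h1
    · rw [hMo₁z k h1, hF₁z k h1]
      simp
    rcases Nat.lt_or_ge n₂ (K - k) with h2 | h2
    · rw [hMo₂z (K - k) h2, hF₂z (K - k) h2]
      simp
    exact prod_bound_one n₁ n₂ k (K - k) Mc₁ Mc₂ F₁ Mo₁ F₂ Mo₂ h1 h2 (by omega) hF₁sym hMo₁odd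
      hMo₁pos hMo₁up hF₂sym hMo₂odd hMo₂pos hMo₂up
  have hS := sum_nonneg hterm
  rw [sum_add_distrib, ← mul_sum] at hS
  have hS' : 0 ≤ (n₁ : ℝ) * n₂ * ∑ k ∈ range (K + 1), Mo₁ k * Mo₂ (K - k) +
      Mc₁ * Mc₂ * ∑ k ∈ range (K + 1),
        ((2 * (k : ℝ) - n₁) * (2 * (k : ℝ) - n₁ + 1)) * (F₁ k * F₂ (K - k)) := by
    have e : ∑ k ∈ range (K + 1), ((2 * (k : ℝ) - n₁) * (2 * (k : ℝ) - n₁ + 1)) * (Mc₁ * Mc₂) *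
        (F₁ k * F₂ (K - k)) = Mc₁ * Mc₂ * ∑ k ∈ range (K + 1),
        ((2 * (k : ℝ) - n₁) * (2 * (k : ℝ) - n₁ + 1)) * (F₁ k * F₂ (K - k)) := by
      rw [mul_sum]
      refine sum_congr rfl fun k _ => ?_
      ring
    rw [e] at hS
    exact hS
  have hB2 := offcentre_moment_bound n₁ n₂ K hN hn₁ F₁ F₂ hF₁0 hF₁z hF₁sym hF₁step hF₂0 hF₂z hF₂sym
    hF₂step
  have hMM : 0 ≤ Mc₁ * Mc₂ := mul_nonneg hMc₁ hMc₂
  have hnn : (0 : ℝ) < (n₁ : ℝ) * n₂ := by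
    have : (1 : ℝ) ≤ n₁ := by exact_mod_cast hn₁
    have : (1 : ℝ) ≤ n₂ := by exact_mod_cast hn₂
    positivity
  have hN0 : (0 : ℝ) ≤ (n₁ : ℝ) + n₂ := by positivity
  have h3 : 0 ≤ (n₁ : ℝ) * n₂ * (((n₁ : ℝ) + n₂) * ∑ k ∈ range (K + 1), Mo₁ k * Mo₂ (K - k) +
      Mc₁ * Mc₂ * ∑ k ∈ range (K + 1), F₁ k * F₂ (K - k)) := by
    have h4 := mul_le_mul_of_nonneg_left hB2 hMM
    have h5 := mul_nonneg hN0 hS'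
    nlinarith [h4, h5]
  exact nonneg_of_mul_nonneg_right h3 hnn

end OffCentre

end Summit.CriticalPhenomena.PercolationContinuityZ3.Theorems
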